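import Literature.MathematicalPhysics.QuantumLattice.KomaPiFluxInfraredBound
import HarnessLib

/-!
# The thermal two-point bound for the `Γ¹`-modes of Koma's `π`-flux BCS model (Koma 2022, (6.13)–(6.16))

T. Koma, *Nambu–Goldstone modes for superconducting lattice fermions*, arXiv:2201.13135 (2022)
[Koma2022], §6, (6.13)–(6.16): with `g_p = ½⟨Γ̂¹_pΓ̂¹_{-p} + Γ̂¹_{-p}Γ̂¹_p⟩`, `b_p = (Γ̂¹_p, Γ̂¹_{-p})`
(Duhamel) and `c_p = ⟨[Γ̂¹_{-p}, [H(B,0), Γ̂¹_p]]⟩`, the Falk–Bruch / Dyson–Lieb–Simon transfer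
[DLS1978, Thms. 3.1–3.2] gives `g_p ≤ ½[b_p + √(b_p² + βb_pc_p)] ≤ b₀ + ½√(βb₀c_p)` for any bound
`b_p ≤ b₀`, and the infrared bound (6.9)/(6.11) supplies `b₀`. This file records that step for the
model in Lieb's frame (`KomaPiFlux.hamiltonian`, files `KomaPiFluxBCSModel.lean` …
`KomaPiFluxInfraredBound.lean`), in the real form with the cosine and sine modes
`C_p = Σ_x cos(p·x)Γ¹_x`, `S_p = Σ_x sin(p·x)Γ¹_x` (`gammaOneMode (cosWave p)`, `… (sinWave p)`),
for which `|Λ| g_p = ⟨C_p² + S_p²⟩` and `|Λ| b_p = (C_p,C_p) + (S_p,S_p)`: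

* **`KomaPiFlux.gibbs_modes_le`** — for `κ ≥ 0`, `g > 0`, `β > 0`, any `U`, `B` and `E_p > 0`:
  `⟨C_p²⟩ + ⟨S_p²⟩ ≤ b₀ + ½ √(β b₀ (c(C_p) + c(S_p)))`, `b₀ = |Λ|/(βgE_p)`,
  `c(A) = ⟨A[H,A] - [H,A]A⟩ = ⟨[A,[H,A]]⟩ ≥ 0` the double commutator in the Gibbs state of `H(B,0)`
  — Koma's (6.16) with (6.11) inserted (his constant `1/(2βgE_p)` reads `1/(βgE_p)` here, see the
  module docstring of `KomaPiFluxInfraredBound.lean`), the double commutator left symbolic.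

The evaluation of the double commutator, (6.25)–(6.33) (`≤ 8d|κ| + 4dgE₁`), the sum rule
(6.17)–(6.24), Appendix B and the long-range order (Thm. 2.1) are NOT here.

## References

* [Koma2022] T. Koma, arXiv:2201.13135, (6.11)–(6.16).
* [DLS1978] F. J. Dyson, E. H. Lieb, B. Simon, J. Stat. Phys. 18 (1978) 335, Thms. 3.1–3.2, (44).
-/

noncomputable section

namespace Literature.MathematicalPhysics.QuantumLattice

open Matrix Finset HubbardWave0 NormedSpace PairHopRP LiebCutRP PairHopCutRP
open Literature.Probability.LatticeModels

namespace KomaPiFlux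

attribute [local instance] LiebCutRP.decEqTorus

variable {d L : ℕ} [NeZero L]

/-- The thermal double commutator `c(A) = ⟨A(HA - AH) - (HA - AH)A⟩_{β,H} = ⟨[A, [H, A]]⟩_{β,H}` (Koma's
`c_p` of (6.15) for `A = Γ̂¹`). [cite: Koma2022, (6.15)] [cite: DLS1978, Thm. 3.2] -/
def doubleComm (β : ℝ) (H A : Matrix (Finset (Orb (FermionTorus (d + 1) L))) (Finset (Orb (FermionTorus (d + 1) L))) ℂ) : ℝ :=
  (gibbsState β H (A * (H * A - A * H) - (H * A - A * H) * A)).re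

/-- **Koma's (6.16) with the infrared bound inserted, in Lieb's frame (real form).** On the even
torus `(ℤ/Lℤ)^{d+1}`, `L ≥ 4`, for `κ ≥ 0`, `g > 0`, `β > 0`, any `U`, `B`, and every momentum `p`
with `E_p > 0`: the thermal expectations of the squared `Γ¹`-modes in the Gibbs state of `H(B, 0)`
obey `⟨C_p²⟩ + ⟨S_p²⟩ ≤ b₀ + ½ √(β b₀ (c(C_p) + c(S_p)))` with `b₀ = |Λ|/(β g E_p)` — the
Falk–Bruch transfer [DLS1978, Thm. 3.2] (tree: `Matrix.falkBruch_sum_le_of_le`) of the Duhamel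
bound `(C_p,C_p) + (S_p,S_p) ≤ b₀` (`duhamel_modes_le`, Koma (6.9)/(6.11)).
[cite: Koma2022, (6.13)–(6.16)] [cite: DLS1978, Thms. 3.1–3.2] -/
theorem gibbs_modes_le (hL : Even L) (h4 : 4 ≤ L) {β : ℝ} (hβ : 0 < β) {κ : ℝ} (hκ : 0 ≤ κ) (U : ℝ)
    {g : ℝ} (hg : 0 < g) (B : ℝ) {p : TorusSite (d + 1) L} (hp : 0 < dispersion (latticeMomentum L p)) :
    (gibbsState β (hamiltonian κ U g (fun (_ _ : FermionTorus (d + 1) L) => (0 : ℝ)) B)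
        (gammaOneMode (cosWave p) * gammaOneMode (cosWave p))).re +
      (gibbsState β (hamiltonian κ U g (fun (_ _ : FermionTorus (d + 1) L) => (0 : ℝ)) B)
        (gammaOneMode (sinWave p) * gammaOneMode (sinWave p))).re ≤
      (L : ℝ) ^ (d + 1) / (β * g * dispersion (latticeMomentum L p)) +
        1 / 2 * Real.sqrt (β * ((L : ℝ) ^ (d + 1) / (β * g * dispersion (latticeMomentum L p))) *
          (doubleComm β (hamiltonian κ U g (fun (_ _ : FermionTorus (d + 1) L) => (0 : ℝ)) B)
              (gammaOneMode (cosWave p)) +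
            doubleComm β (hamiltonian κ U g (fun (_ _ : FermionTorus (d + 1) L) => (0 : ℝ)) B)
              (gammaOneMode (sinWave p)))) := by
  set H₀ := hamiltonian κ U g (fun (_ _ : FermionTorus (d + 1) L) => (0 : ℝ)) B with hH₀
  have hH : H₀.IsHermitian := hamiltonian_isHermitian (G d L) (piFluxAmpl κ) (piFluxAmpl_herm κ) U g _ B
  have hA : ∀ k : Fin 2, (![gammaOneMode (cosWave p), gammaOneMode (sinWave p)] k).IsHermitian := by
    intro k
    fin_cases k
    · exact gammaOneMode_isHermitian _
    · exact gammaOneMode_isHermitian _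
  have hb : ∑ k : Fin 2, (duhamel β H₀ (![gammaOneMode (cosWave p), gammaOneMode (sinWave p)] k)
      (![gammaOneMode (cosWave p), gammaOneMode (sinWave p)] k)).re ≤
      (L : ℝ) ^ (d + 1) / (β * g * dispersion (latticeMomentum L p)) := by
    rw [Fin.sum_univ_two]
    exact duhamel_modes_le hL h4 hβ hκ U hg B hp
  have h := falkBruch_sum_le_of_le hH hβ.le hA hb
  simp only [Fin.sum_univ_two, Matrix.cons_val_zero, Matrix.cons_val_one] at h
  exact h

/-- The double commutators in (6.16) are nonnegative (so the square root is of a nonnegative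
number). [cite: DLS1978, Thm. 3.2] [cite: Koma2022, (6.22) ("the positivity of `c_p`")] -/
theorem doubleComm_nonneg {β : ℝ} (hβ : 0 ≤ β) (κ U g : ℝ) (h : FermionTorus (d + 1) L → FermionTorus (d + 1) L → ℝ)
    (B : ℝ) {A : Matrix (Finset (Orb (FermionTorus (d + 1) L))) (Finset (Orb (FermionTorus (d + 1) L))) ℂ}
    (hA : A.IsHermitian) : 0 ≤ doubleComm β (hamiltonian κ U g h B) A :=
  (hamiltonian_isHermitian (G d L) (piFluxAmpl κ) (piFluxAmpl_herm κ) U g h B).re_gibbsState_doubleComm_nonneg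
    hA hβ

end KomaPiFlux

end Literature.MathematicalPhysics.QuantumLattice

end
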